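import Summits.ValiantsHypothesis.ValiantsHypothesis.Theorems.LacunarySymmetroidMatrixDescartesCensusDoorA34Coeffs
import Summits.ValiantsHypothesis.ValiantsHypothesis.Theorems.LacunarySymmetroidMatrixDescartesCensusDoorA34TwoSingularLetters

/-!
# `MatrixDescartes` census — DOOR A at `(3,4)`: ANATOMY OF A NULL-TOP EIGHTEEN — what a counterexample to `stub_nullTopCeiling` must look like
# (all `19` surviving slots present, pairwise distinct, every slot coefficient non-zero) and the codimension-one closures this yields

HONEST FRAMING.  Object-search cell `pub-symmetroid`, engine seat `val-sym-eng-2` (g4); helper rows beside the registered strata line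
`Cruxes/DoorA34/Lines/strata.lean` on stmt-ValiantsHypothesis-19980 (`DoorA34 = PosRootLawAt 3 4 18`: OPEN, typed, never asserted here).
Stub `stub_nullTopCeiling`: symmetric letters, `StrictMono d`, `det S₃ = 0` ⇒ `≤ 17` positive roots.  This file is the null-top analogue of the
cell's F1 row for nineteens (`Census.det_letter_ne_zero_of_nineteen`, …DoorA34Letters): it lists, in the kernel, what an EIGHTEEN ON THE NULL-TOP
SHEET (a counterexample to the stub) must satisfy, for ANY real letters (symmetry is never used) —

* `support_det_pencil_subset_of_nullTop` — with `det S₃ = 0` the support of `det F` lies in the image of the `19` multisets `s ≠ {3,3,3}` of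
  `Sym (Fin 4) 3` under `s ↦ Σ_{l∈s} d_l` (ANY `d`: if the top cube exponent is hit only by `{3,3,3}` its coefficient is `det S₃ = 0`, otherwise it is
  hit by another multiset anyway); `card_support_le_19_of_nullTop`;
* `support_det_pencil_eq_of_nullTop_eighteen`, `sym_sum_injOn_of_nullTop_eighteen`, `coeff_sym_sum_ne_zero_of_nullTop_eighteen` — with `18`
  positive roots the support IS that image, the `19` slot exponents are PAIRWISE DISTINCT and EVERY slot coefficient is non-zero (sparse Descartes,
  `Literature…card_roots_toFinset_filter_pos_lt_card_support`);
* for a sorted support (`StrictMono d`, the stub's hypothesis) the slots are then uncollided (`sym_eq_of_sum_eq_of_nullTop_eighteen`) and the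
  coefficient dictionary (…DoorA34Coeffs / …Letters) names them: `det_letter_ne_zero_of_nullTop_eighteen` (`det S_l ≠ 0`, `l < 3`),
  `trace_adjugate_top_mul_ne_zero_of_nullTop_eighteen` (`tr(adj S₃·S_l) ≠ 0`, `l < 3` — the three TOP-WINDOW coefficients),
  `trace_adjugate_mul_top_ne_zero_of_nullTop_eighteen` (`tr(adj S_l·S₃) ≠ 0`, `l < 3` — the three SQUARE middle-window coefficients),
  `trace_adjugate_mul_ne_zero_of_nullTop_eighteen` (`tr(adj S_i·S_k) ≠ 0`, `i ≠ k < 3` — the six square core coefficients),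
  `mixed_top_ne_zero_of_nullTop_eighteen` / `mixed_core_ne_zero_of_nullTop_eighteen` (the four fully polarised coefficients);
* hence the CODIMENSION-ONE CLOSURES of the stub (each: `StrictMono d`, `det S₃ = 0`, one more vanishing ⇒ `≤ 17`):
  `posRoots_le_17_of_nullTop_of_det_letter_eq_zero` (a second singular letter, now also a MIDDLE one),
  `posRoots_le_17_of_nullTop_of_trace_adjugate_top_mul_eq_zero` (`tr(adj S₃·S_l) = 0`, all three `l` — p575885 had `l = 2`),
  `posRoots_le_17_of_nullTop_of_trace_adjugate_mul_top_eq_zero` (`tr(adj S_l·S₃) = 0`), `posRoots_le_17_of_nullTop_of_trace_adjugate_mul_eq_zero`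
  (`tr(adj S_i·S_k) = 0`, `i ≠ k < 3`), `posRoots_le_17_of_nullTop_of_mixed_top_eq_zero`, `posRoots_le_17_of_nullTop_of_mixed_core_eq_zero`.

So the OPEN content of `stub_nullTopCeiling` is exactly the FULL null-top sheet: sorted support with the `19` slot exponents distinct and all `19` slot
coefficients (`3` cubes, `9` squares, `4` mixed, `3` top-window) non-zero — `16` codimension-one walls are closed by monomial count.  Nothing here bounds
anything on that open sheet; `DoorA34` and the three stubs stay OPEN; registers unchanged; nothing on `MatrixDescartes` (stmt-ValiantsHypothesis-18050) or
`VP ≠ VNP` — VP≠VNP not moved.  [folklore] Sparse Descartes rule + multilinearity of the determinant; elementary.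
-/

-- `Summit.ValiantsHypothesis.ValiantsHypothesis.…` repeats a component by the D-0017 layout
-- (single-conjunct summit), which the `dupNamespace` linter flags; the name is mandated.
set_option linter.dupNamespace false

namespace Summit.ValiantsHypothesis.ValiantsHypothesis.Theorems.LacunarySymmetroidMatrixDescartes.Census

open Polynomial Finset
open scoped BigOperators Polynomial Matrix

/-- The multiset of values of `f : Fin 3 → Fin 4`, as an element of `Sym (Fin 4) 3`, has the exponent `Σᵢ d (f i)`. [folklore] -/
theorem sym_sum_of_fun (d : Fin 4 → ℕ) (f : Fin 3 → Fin 4) :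
    (((⟨Finset.univ.val.map f, StubDescartesCeiling.card_map_univ_val f⟩ : Sym (Fin 4) 3) : Multiset (Fin 4)).map d).sum
      = ∑ i, d (f i) := by
  rw [StubDescartesCeiling.sum_eq_sym_sum]

/-- A constant map has the replicate multiset: if the value multiset of `f` is `{l,l,l}` then `f ≡ l`. [folklore] -/
theorem fun_const_of_sym_eq_replicate (f : Fin 3 → Fin 4) (l : Fin 4)
    (h : (⟨Finset.univ.val.map f, StubDescartesCeiling.card_map_univ_val f⟩ : Sym (Fin 4) 3) = Sym.replicate 3 l) (i : Fin 3) :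
    f i = l := by
  have hmem : f i ∈ (Finset.univ.val.map f : Multiset (Fin 4)) := Multiset.mem_map_of_mem f (Finset.mem_univ_val i)
  have hval : (Finset.univ.val.map f : Multiset (Fin 4)) = Multiset.replicate 3 l := by
    have := congrArg (fun s : Sym (Fin 4) 3 => (s : Multiset (Fin 4))) h
    simpa [Sym.coe_replicate] using this
  rw [hval] at hmem
  exact Multiset.eq_of_mem_replicate hmem

/-- **Support on the null-top stratum (any `d`, any real letters).**  If `det S₃ = 0`, every monomial of `det (∑ l, X^(d l) • S l)` is the
sum of a multiset `s ≠ {3,3,3}`: the support lies in the image of `univ.erase (Sym.replicate 3 3)`. [folklore] -/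
theorem support_det_pencil_subset_of_nullTop (d : Fin 4 → ℕ) (S : Fin 4 → Matrix (Fin 3) (Fin 3) ℝ) (h3 : (S 3).det = 0) :
    (Matrix.det (∑ l, ((X : ℝ[X]) ^ d l) • (S l).map C)).support
      ⊆ ((Finset.univ : Finset (Sym (Fin 4) 3)).erase (Sym.replicate 3 3)).image
          (fun s : Sym (Fin 4) 3 => ((s : Multiset (Fin 4)).map d).sum) := by
  intro n hn
  by_contra hnot
  -- every row-to-letter map with exponent `n` is the constant map `3`
  have hconst : ∀ f : Fin 3 → Fin 4, (∑ i, d (f i)) = n → ∀ i, f i = 3 := by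
    intro f hf i
    set sf : Sym (Fin 4) 3 := ⟨Finset.univ.val.map f, StubDescartesCeiling.card_map_univ_val f⟩ with hsf
    by_cases hs : sf = Sym.replicate 3 3
    · exact fun_const_of_sym_eq_replicate f 3 hs i
    · exfalso
      refine hnot (Finset.mem_image.mpr ⟨sf, Finset.mem_erase.mpr ⟨hs, Finset.mem_univ _⟩, ?_⟩)
      rw [← hf]
      exact sym_sum_of_fun d f
  -- hence `n = 3·d 3` is represented only by `{3,3,3}` and its coefficient is `det S₃ = 0`
  have hmem := StubDescartesCeiling.support_det_pencil_subset d S hn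
  obtain ⟨s, -, hs⟩ := Finset.mem_image.mp hmem
  have hn3 : n = 3 * d 3 := by
    -- pick any `f` realising `n`: the coefficient is non-zero so some map contributes; use the constant map description
    have hne : (Matrix.det (∑ l, ((X : ℝ[X]) ^ d l) • (S l).map C)).coeff n ≠ 0 := mem_support_iff.mp hn
    by_contra hne3
    refine hne (StubDescartesCeiling.coeff_det_pencil_eq_zero d S fun f hf => ?_)
    have hc := hconst f hf
    apply hne3
    rw [← hf]
    simp only [hc, Finset.sum_const, Finset.card_univ, Fintype.card_fin, smul_eq_mul]
  subst hn3
  have huniq : ∀ f : Fin 3 → Fin 4, (∑ i, d (f i)) = 3 * d 3 → ∀ i, f i = 3 := hconst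
  have hc := coeff_det_pencil_three_mul d S 3 huniq
  rw [mem_support_iff, hc, h3] at hn
  exact hn rfl

/-- On the null-top stratum the determinant has at most `19` monomials (any `d`, any letters). [folklore] -/
theorem card_support_le_19_of_nullTop (d : Fin 4 → ℕ) (S : Fin 4 → Matrix (Fin 3) (Fin 3) ℝ) (h3 : (S 3).det = 0) :
    (Matrix.det (∑ l, ((X : ℝ[X]) ^ d l) • (S l).map C)).support.card ≤ 19 := by
  refine (Finset.card_le_card (support_det_pencil_subset_of_nullTop d S h3)).trans (Finset.card_image_le.trans ?_)
  rw [Finset.card_erase_of_mem (Finset.mem_univ _), Finset.card_univ, Sym.card_sym_eq_choose]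
  decide

/-- **`18` roots on the null-top sheet force all `19` slots.**  With `det S₃ = 0` and `18` distinct positive roots the support of the determinant
IS the image of the `19` multisets `s ≠ {3,3,3}`. [folklore] -/
theorem support_det_pencil_eq_of_nullTop_eighteen (d : Fin 4 → ℕ) (S : Fin 4 → Matrix (Fin 3) (Fin 3) ℝ) (h3 : (S 3).det = 0)
    (h18 : 18 ≤ ((Matrix.det (∑ l, ((X : ℝ[X]) ^ d l) • (S l).map C)).roots.toFinset.filter (fun t => 0 < t)).card) :
    (Matrix.det (∑ l, ((X : ℝ[X]) ^ d l) • (S l).map C)).support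
      = ((Finset.univ : Finset (Sym (Fin 4) 3)).erase (Sym.replicate 3 3)).image
          (fun s : Sym (Fin 4) 3 => ((s : Multiset (Fin 4)).map d).sum) := by
  have hP : Matrix.det (∑ l, ((X : ℝ[X]) ^ d l) • (S l).map C) ≠ 0 := by
    intro h
    rw [h, Polynomial.roots_zero, Multiset.toFinset_zero, Finset.filter_empty, Finset.card_empty] at h18
    omega
  have hlt := Literature.Computability.AlgebraicComplexity.card_roots_toFinset_filter_pos_lt_card_support hP
  have hsub := support_det_pencil_subset_of_nullTop d S h3
  have hcard : (((Finset.univ : Finset (Sym (Fin 4) 3)).erase (Sym.replicate 3 3)).image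
      (fun s : Sym (Fin 4) 3 => ((s : Multiset (Fin 4)).map d).sum)).card ≤ 19 := by
    refine Finset.card_image_le.trans ?_
    rw [Finset.card_erase_of_mem (Finset.mem_univ _), Finset.card_univ, Sym.card_sym_eq_choose]
    decide
  exact Finset.eq_of_subset_of_card_le hsub (by omega)

/-- With `18` roots on the null-top sheet the `19` slot exponents are PAIRWISE DISTINCT: `s ↦ Σ_{l∈s} d_l` is injective on the multisets
`s ≠ {3,3,3}`. [folklore] -/
theorem sym_sum_injOn_of_nullTop_eighteen (d : Fin 4 → ℕ) (S : Fin 4 → Matrix (Fin 3) (Fin 3) ℝ) (h3 : (S 3).det = 0)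
    (h18 : 18 ≤ ((Matrix.det (∑ l, ((X : ℝ[X]) ^ d l) • (S l).map C)).roots.toFinset.filter (fun t => 0 < t)).card) :
    Set.InjOn (fun s : Sym (Fin 4) 3 => ((s : Multiset (Fin 4)).map d).sum)
      ↑((Finset.univ : Finset (Sym (Fin 4) 3)).erase (Sym.replicate 3 3)) := by
  have hP : Matrix.det (∑ l, ((X : ℝ[X]) ^ d l) • (S l).map C) ≠ 0 := by
    intro h
    rw [h, Polynomial.roots_zero, Multiset.toFinset_zero, Finset.filter_empty, Finset.card_empty] at h18
    omega
  have hlt := Literature.Computability.AlgebraicComplexity.card_roots_toFinset_filter_pos_lt_card_support hP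
  have heq := support_det_pencil_eq_of_nullTop_eighteen d S h3 h18
  have h19 : ((Finset.univ : Finset (Sym (Fin 4) 3)).erase (Sym.replicate 3 3)).card = 19 := by
    rw [Finset.card_erase_of_mem (Finset.mem_univ _), Finset.card_univ, Sym.card_sym_eq_choose]; decide
  rw [← Finset.card_image_iff]
  refine le_antisymm Finset.card_image_le ?_
  rw [← heq, h19]
  omega

/-- With `18` roots on the null-top sheet EVERY slot coefficient is non-zero: `coeff (Σ_{l∈s} d_l) ≠ 0` for all `s ≠ {3,3,3}`. [folklore] -/
theorem coeff_sym_sum_ne_zero_of_nullTop_eighteen (d : Fin 4 → ℕ) (S : Fin 4 → Matrix (Fin 3) (Fin 3) ℝ) (h3 : (S 3).det = 0)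
    (h18 : 18 ≤ ((Matrix.det (∑ l, ((X : ℝ[X]) ^ d l) • (S l).map C)).roots.toFinset.filter (fun t => 0 < t)).card)
    (s : Sym (Fin 4) 3) (hs : s ≠ Sym.replicate 3 3) :
    (Matrix.det (∑ l, ((X : ℝ[X]) ^ d l) • (S l).map C)).coeff (((s : Multiset (Fin 4)).map d).sum) ≠ 0 := by
  rw [← mem_support_iff, support_det_pencil_eq_of_nullTop_eighteen d S h3 h18]
  exact Finset.mem_image.mpr ⟨s, Finset.mem_erase.mpr ⟨hs, Finset.mem_univ _⟩, rfl⟩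

/-- For a sorted support every multiset `s ≠ {3,3,3}` has exponent `< 3·d 3`. [folklore] -/
theorem sym_sum_lt_top_of_strictMono (d : Fin 4 → ℕ) (hd : StrictMono d) (s : Sym (Fin 4) 3) (hs : s ≠ Sym.replicate 3 3) :
    ((s : Multiset (Fin 4)).map d).sum < 3 * d 3 := by
  have hle : ∀ l : Fin 4, d l ≤ d 3 := fun l => hd.monotone (Fin.le_last l)
  obtain ⟨a, ha, ha3⟩ : ∃ a ∈ (s : Multiset (Fin 4)), a ≠ 3 := by
    by_contra hall
    exact hs (Sym.eq_replicate_iff.2 fun b hb => by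
      by_contra hb3
      exact hall ⟨b, hb, hb3⟩)
  obtain ⟨t, ht⟩ := Multiset.exists_cons_of_mem ha
  have hcard : Multiset.card t = 2 := by
    have hcs : Multiset.card (s : Multiset (Fin 4)) = 3 := Sym.card_coe
    rw [ht, Multiset.card_cons] at hcs
    omega
  have hlt : d a < d 3 := hd (lt_of_le_of_ne (Fin.le_last a) ha3)
  have hsum_t : (t.map d).sum ≤ 2 * d 3 := by
    have h := Multiset.sum_le_card_nsmul (t.map d) (d 3) (by
      intro x hx
      obtain ⟨l, -, rfl⟩ := Multiset.mem_map.mp hx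
      exact hle l)
    simpa [hcard] using h
  rw [ht, Multiset.map_cons, Multiset.sum_cons]
  omega

/-- **Uncollided slots.**  On a sorted support with `det S₃ = 0` and `18` roots, every row-to-letter map realising the exponent of a slot
`s ≠ {3,3,3}` has value multiset exactly `s`. [folklore] -/
theorem sym_eq_of_sum_eq_of_nullTop_eighteen (d : Fin 4 → ℕ) (hd : StrictMono d) (S : Fin 4 → Matrix (Fin 3) (Fin 3) ℝ) (h3 : (S 3).det = 0)
    (h18 : 18 ≤ ((Matrix.det (∑ l, ((X : ℝ[X]) ^ d l) • (S l).map C)).roots.toFinset.filter (fun t => 0 < t)).card)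
    (s : Sym (Fin 4) 3) (hs : s ≠ Sym.replicate 3 3) (f : Fin 3 → Fin 4)
    (hf : (∑ i, d (f i)) = ((s : Multiset (Fin 4)).map d).sum) :
    (⟨Finset.univ.val.map f, StubDescartesCeiling.card_map_univ_val f⟩ : Sym (Fin 4) 3) = s := by
  set sf : Sym (Fin 4) 3 := ⟨Finset.univ.val.map f, StubDescartesCeiling.card_map_univ_val f⟩ with hsf
  have hsum : ((sf : Multiset (Fin 4)).map d).sum = ((s : Multiset (Fin 4)).map d).sum := by
    rw [← hf]; exact sym_sum_of_fun d f
  have hsf3 : sf ≠ Sym.replicate 3 3 := by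
    intro h
    have hlt := sym_sum_lt_top_of_strictMono d hd s hs
    have hc : ∀ i, f i = 3 := fun i => fun_const_of_sym_eq_replicate f 3 h i
    have : (∑ i, d (f i)) = 3 * d 3 := by
      simp only [hc, Finset.sum_const, Finset.card_univ, Fintype.card_fin, smul_eq_mul]
    omega
  exact sym_sum_injOn_of_nullTop_eighteen d S h3 h18 (Finset.mem_coe.2 (Finset.mem_erase.mpr ⟨hsf3, Finset.mem_univ _⟩))
    (Finset.mem_coe.2 (Finset.mem_erase.mpr ⟨hs, Finset.mem_univ _⟩)) hsum

/-- Row-to-letter maps with value multiset `{i,i,k}` (`i ≠ k`) are the three arrangements of `(i,i,k)`. [folklore] -/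
theorem fun_eq_of_map_univ_eq_pair : ∀ (i k : Fin 4), i ≠ k → ∀ f : Fin 3 → Fin 4,
    (Finset.univ.val.map f : Multiset (Fin 4)) = {i, i, k} → (f = ![i, i, k] ∨ f = ![i, k, i] ∨ f = ![k, i, i]) := by
  decide +kernel

/-- Row-to-letter maps with value multiset `{i,j,k}` (pairwise distinct) are the six arrangements. [folklore] -/
theorem fun_eq_of_map_univ_eq_triple : ∀ (i j k : Fin 4), i ≠ j → i ≠ k → j ≠ k → ∀ f : Fin 3 → Fin 4,
    (Finset.univ.val.map f : Multiset (Fin 4)) = {i, j, k} →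
      (f = ![i, j, k] ∨ f = ![i, k, j] ∨ f = ![j, i, k] ∨ f = ![j, k, i] ∨ f = ![k, i, j] ∨ f = ![k, j, i]) := by
  decide +kernel

/-- **CUBES.**  On a sorted support, `det S₃ = 0` and `18` positive roots force the three lower letters to be NON-SINGULAR. [folklore] -/
theorem det_letter_ne_zero_of_nullTop_eighteen (d : Fin 4 → ℕ) (hd : StrictMono d) (S : Fin 4 → Matrix (Fin 3) (Fin 3) ℝ)
    (h3 : (S 3).det = 0)
    (h18 : 18 ≤ ((Matrix.det (∑ l, ((X : ℝ[X]) ^ d l) • (S l).map C)).roots.toFinset.filter (fun t => 0 < t)).card)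
    (l : Fin 4) (hl : l ≠ 3) : (S l).det ≠ 0 := by
  have hs : Sym.replicate 3 l ≠ Sym.replicate 3 (3 : Fin 4) := fun h => hl ((Sym.replicate_right_inj (by norm_num)).1 h)
  have key := coeff_sym_sum_ne_zero_of_nullTop_eighteen d S h3 h18 _ hs
  have hσ : (((Sym.replicate 3 l : Sym (Fin 4) 3) : Multiset (Fin 4)).map d).sum = 3 * d l := by
    simp only [Sym.coe_replicate, Multiset.map_replicate, Multiset.sum_replicate, smul_eq_mul]
  have huniq : ∀ f : Fin 3 → Fin 4, (∑ i, d (f i)) = 3 * d l → ∀ i, f i = l := by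
    intro f hf i
    exact fun_const_of_sym_eq_replicate f l (sym_eq_of_sum_eq_of_nullTop_eighteen d hd S h3 h18 _ hs f (hf.trans hσ.symm)) i
  rwa [hσ, coeff_det_pencil_three_mul d S l huniq] at key

/-- **SQUARES.**  On a sorted support, `det S₃ = 0` and `18` positive roots force `tr(adj S_i · S_k) ≠ 0` for ALL `i ≠ k` — the three
TOP-WINDOW coefficients (`i = 3`: `tr(adj S₃·S_k)`, `k = 0,1,2`), the three square MIDDLE-window coefficients (`k = 3`) and the six square
CORE coefficients. [folklore] -/
theorem trace_adjugate_mul_ne_zero_of_nullTop_eighteen (d : Fin 4 → ℕ) (hd : StrictMono d) (S : Fin 4 → Matrix (Fin 3) (Fin 3) ℝ)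
    (h3 : (S 3).det = 0)
    (h18 : 18 ≤ ((Matrix.det (∑ l, ((X : ℝ[X]) ^ d l) • (S l).map C)).roots.toFinset.filter (fun t => 0 < t)).card)
    (i k : Fin 4) (hik : i ≠ k) : ((S i).adjugate * S k).trace ≠ 0 := by
  set s : Sym (Fin 4) 3 := ⟨{i, i, k}, by simp⟩ with hsdef
  have hs : s ≠ Sym.replicate 3 (3 : Fin 4) := by
    intro h
    have hmem : k ∈ (s : Multiset (Fin 4)) := by simp [hsdef]
    have hmem' : i ∈ (s : Multiset (Fin 4)) := by simp [hsdef]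
    rw [h] at hmem hmem'
    rw [Sym.coe_replicate] at hmem hmem'
    exact hik ((Multiset.eq_of_mem_replicate hmem').trans (Multiset.eq_of_mem_replicate hmem).symm)
  have key := coeff_sym_sum_ne_zero_of_nullTop_eighteen d S h3 h18 s hs
  have hσ : ((s : Multiset (Fin 4)).map d).sum = 2 * d i + d k := by
    simp only [hsdef, Sym.coe_mk, Multiset.insert_eq_cons, Multiset.map_cons, Multiset.sum_cons, Multiset.map_singleton,
      Multiset.sum_singleton]
    ring
  have huniq : ∀ f : Fin 3 → Fin 4, (∑ t, d (f t)) = 2 * d i + d k → f = ![i, i, k] ∨ f = ![i, k, i] ∨ f = ![k, i, i] := by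
    intro f hf
    have h := sym_eq_of_sum_eq_of_nullTop_eighteen d hd S h3 h18 s hs f (hf.trans hσ.symm)
    have hval : (Finset.univ.val.map f : Multiset (Fin 4)) = {i, i, k} := by
      have := congrArg (fun u : Sym (Fin 4) 3 => (u : Multiset (Fin 4))) h
      simpa [hsdef] using this
    exact fun_eq_of_map_univ_eq_pair i k hik f hval
  rwa [hσ, coeff_det_pencil_three_square d S hik huniq] at key

/-- **MIXED.**  On a sorted support, `det S₃ = 0` and `18` positive roots force the four fully polarised coefficients
`tr((adj(S_i + S_j) − adj S_i − adj S_j) · S_k) ≠ 0` (`i, j, k` pairwise distinct). [folklore] -/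
theorem mixed_ne_zero_of_nullTop_eighteen (d : Fin 4 → ℕ) (hd : StrictMono d) (S : Fin 4 → Matrix (Fin 3) (Fin 3) ℝ)
    (h3 : (S 3).det = 0)
    (h18 : 18 ≤ ((Matrix.det (∑ l, ((X : ℝ[X]) ^ d l) • (S l).map C)).roots.toFinset.filter (fun t => 0 < t)).card)
    (i j k : Fin 4) (hij : i ≠ j) (hik : i ≠ k) (hjk : j ≠ k) :
    (((S i + S j).adjugate - (S i).adjugate - (S j).adjugate) * S k).trace ≠ 0 := by
  set s : Sym (Fin 4) 3 := ⟨{i, j, k}, by simp⟩ with hsdef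
  have hs : s ≠ Sym.replicate 3 (3 : Fin 4) := by
    intro h
    have hmem : i ∈ (s : Multiset (Fin 4)) := by simp [hsdef]
    have hmem' : j ∈ (s : Multiset (Fin 4)) := by simp [hsdef]
    rw [h] at hmem hmem'
    rw [Sym.coe_replicate] at hmem hmem'
    exact hij ((Multiset.eq_of_mem_replicate hmem).trans (Multiset.eq_of_mem_replicate hmem').symm)
  have key := coeff_sym_sum_ne_zero_of_nullTop_eighteen d S h3 h18 s hs
  have hσ : ((s : Multiset (Fin 4)).map d).sum = d i + d j + d k := by
    simp only [hsdef, Sym.coe_mk, Multiset.insert_eq_cons, Multiset.map_cons, Multiset.sum_cons, Multiset.map_singleton,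
      Multiset.sum_singleton]
    ring
  have huniq : ∀ f : Fin 3 → Fin 4, (∑ t, d (f t)) = d i + d j + d k →
      f = ![i, j, k] ∨ f = ![i, k, j] ∨ f = ![j, i, k] ∨ f = ![j, k, i] ∨ f = ![k, i, j] ∨ f = ![k, j, i] := by
    intro f hf
    have h := sym_eq_of_sum_eq_of_nullTop_eighteen d hd S h3 h18 s hs f (hf.trans hσ.symm)
    have hval : (Finset.univ.val.map f : Multiset (Fin 4)) = {i, j, k} := by
      have := congrArg (fun u : Sym (Fin 4) 3 => (u : Multiset (Fin 4))) h
      simpa [hsdef] using this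
    exact fun_eq_of_map_univ_eq_triple i j k hij hik hjk f hval
  rwa [hσ, coeff_det_pencil_three_mixed d S hij hik hjk huniq] at key

/-- **CLOSURE 1 — a second singular letter.**  Sorted support, `det S₃ = 0` and `det S_l = 0` for some `l ≠ 3` (a singular BOTTOM or MIDDLE
letter) ⇒ at most `17` distinct positive roots (any real letters). [folklore] -/
theorem posRoots_le_17_of_nullTop_of_det_eq_zero (d : Fin 4 → ℕ) (hd : StrictMono d) (S : Fin 4 → Matrix (Fin 3) (Fin 3) ℝ)
    (h3 : (S 3).det = 0) (l : Fin 4) (hl : l ≠ 3) (hdet : (S l).det = 0) :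
    ((Matrix.det (∑ k, ((X : ℝ[X]) ^ d k) • (S k).map C)).roots.toFinset.filter (fun t => 0 < t)).card ≤ 17 := by
  by_contra h
  exact det_letter_ne_zero_of_nullTop_eighteen d hd S h3 (by omega) l hl hdet

/-- **CLOSURE 2 — a vanishing square coefficient.**  Sorted support, `det S₃ = 0` and `tr(adj S_i · S_k) = 0` for some `i ≠ k` ⇒ at most `17`
distinct positive roots.  For `i = 3` these are the three TOP-WINDOW walls `tr(adj S₃·S_k) = 0` (`k = 2` is p575885's sub-stratum; `k = 0, 1` are
new), for `k = 3` the three square middle-window walls, otherwise the six square core walls. [folklore] -/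
theorem posRoots_le_17_of_nullTop_of_trace_adjugate_mul_eq_zero (d : Fin 4 → ℕ) (hd : StrictMono d)
    (S : Fin 4 → Matrix (Fin 3) (Fin 3) ℝ) (h3 : (S 3).det = 0) (i k : Fin 4) (hik : i ≠ k) (htr : ((S i).adjugate * S k).trace = 0) :
    ((Matrix.det (∑ l, ((X : ℝ[X]) ^ d l) • (S l).map C)).roots.toFinset.filter (fun t => 0 < t)).card ≤ 17 := by
  by_contra h
  exact trace_adjugate_mul_ne_zero_of_nullTop_eighteen d hd S h3 (by omega) i k hik htr

/-- **CLOSURE 3 — a vanishing mixed coefficient.**  Sorted support, `det S₃ = 0` and `tr((adj(S_i+S_j) − adj S_i − adj S_j)·S_k) = 0` for some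
pairwise distinct `i, j, k` ⇒ at most `17` distinct positive roots. [folklore] -/
theorem posRoots_le_17_of_nullTop_of_mixed_eq_zero (d : Fin 4 → ℕ) (hd : StrictMono d)
    (S : Fin 4 → Matrix (Fin 3) (Fin 3) ℝ) (h3 : (S 3).det = 0) (i j k : Fin 4) (hij : i ≠ j) (hik : i ≠ k) (hjk : j ≠ k)
    (hmix : (((S i + S j).adjugate - (S i).adjugate - (S j).adjugate) * S k).trace = 0) :
    ((Matrix.det (∑ l, ((X : ℝ[X]) ^ d l) • (S l).map C)).roots.toFinset.filter (fun t => 0 < t)).card ≤ 17 := by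
  by_contra h
  exact mixed_ne_zero_of_nullTop_eighteen d hd S h3 (by omega) i j k hij hik hjk hmix

/-- **The stub's open content, in its own currency.**  `stub_nullTopCeiling` restricted to pencils with a vanishing slot coefficient HOLDS:
for symmetric letters (unused), `StrictMono d`, `det S₃ = 0`, if some lower letter is singular, or some `tr(adj S_i·S_k)` (`i ≠ k`) vanishes, or
some mixed coefficient vanishes, the count is `≤ 17`. [folklore] -/
theorem nullTopCeiling_of_slot_eq_zero (d : Fin 4 → ℕ) (S : Fin 4 → Matrix (Fin 3) (Fin 3) ℝ) (_hS : ∀ l, (S l).IsSymm)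
    (hd : StrictMono d) (h3 : (S 3).det = 0)
    (hslot : (∃ l : Fin 4, l ≠ 3 ∧ (S l).det = 0) ∨ (∃ i k : Fin 4, i ≠ k ∧ ((S i).adjugate * S k).trace = 0) ∨
      (∃ i j k : Fin 4, i ≠ j ∧ i ≠ k ∧ j ≠ k ∧ (((S i + S j).adjugate - (S i).adjugate - (S j).adjugate) * S k).trace = 0)) :
    ((∑ l, (Polynomial.X : Polynomial ℝ) ^ d l • (S l).map Polynomial.C).det.roots.toFinset.filter (fun t => 0 < t)).card ≤ 17 := by
  rcases hslot with ⟨l, hl, hdet⟩ | ⟨i, k, hik, htr⟩ | ⟨i, j, k, hij, hik, hjk, hmix⟩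
  · exact posRoots_le_17_of_nullTop_of_det_eq_zero d hd S h3 l hl hdet
  · exact posRoots_le_17_of_nullTop_of_trace_adjugate_mul_eq_zero d hd S h3 i k hik htr
  · exact posRoots_le_17_of_nullTop_of_mixed_eq_zero d hd S h3 i j k hij hik hjk hmix

end Summit.ValiantsHypothesis.ValiantsHypothesis.Theorems.LacunarySymmetroidMatrixDescartes.Census
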